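import Summits.QuantumFields.BalabanUV.T4Continuum.Support.ShellMeasureLandauPinnedFixedPoint

/-!
# `T4Continuum.ShellMeasureLandauPinnedField` — THE LD CHAIN'S FIXED POINTS READ IN A SECOND NORM (file 2 of 2):
# the exponent field `Z_V = landauExp … (solAt … + 𝔄)` as a function of its datum, and S70 (iv) on the chart ball —
# `‖Z_V(z) − Z_V(0)‖_pin ≤ z_pin` with `z_pin` EXPLICIT in the displayed pinned binders
(cell `pub-balaban`, sub-cell `t4`, spine estimate NE7c (node U5b); NE7c formalisation swarm, crew seat
`b2b-balaban-t4-ne7c-formalise-leaf-07` gen 6 — companion «f2: fixed point pinned» of row S70 «END-II-loc: THE LD CHAIN IN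
TWO NORMS» of `t4/b2b-balaban-t4-ne7c-p1/LEAVES-NE7c-P1.md` (holder lineage `…-leaf-01`, invitation journal l.16173, claim
l.16311); imports file 1 `ShellMeasureLandauPinnedFixedPoint` ONLY; [folklore]; 0 `def`, 0 `def … : Prop`, 0 sorry,
0 citation)

HONEST FRAMING.  Finite four-torus programme, rung (B)+1 only — NOT infinite volume, NOT a mass gap, NOT the Clay
problem, NOT summit progress; (B), `BetaPertHyp`, (B^μ) not consumed.  NE7c (`T4IndicatorShell.ShellWeightBound`) is
NOT PRINTED in [Balaban 1983–89] and NOT PROVED; «NE7c ⇐ the named binders» (trigger c3).  Nothing printed is asserted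
here; no estimate of Bałaban's is discharged.  A-priori fixed-point perturbation ALGEBRA on OUR side (see file 1's
header for the locality road, the honest form of S70 (iii), and the READINGS `π𝒴`, `π𝒴′`, `π𝒳`, `πℬ`).

PINNED BINDERS (DISPLAYED; to be inhabited by S70 f1 ∕ leaf-08's `DCf` file in S69's currency `WSup (pinW δ′ ϖ) 1`):
`hΛp`, `hGWp` (`s = θₚ + q_W < 1`; S70 f1 (ii) for `𝒢 ∘ D(W𝒱)` + file 1 §4), `hCp` ((73)-TYPE), `hιp`, `hHp`
(`k = L_C c_ι B_H < 1`; (46)∕(3.133) decay TYPE), `hH₁p : ‖π𝒴(H₁ B)‖ ≤ B₁ₚ‖πℬ B‖` ((103) decay TYPE),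
`hΦp : ‖πℬ(Φ z)‖ ≤ bₚ` on the chart ball (S70 (i): `Φ V` is block-supported, so its pinned size is its flat size).

WHAT IS PROVED ([folklore]).
* §1 `norm_sub_landauField_le` — `Z(𝔄) := landauExp C ι H (4C₂(ε₄+a)²) (solAt 𝒢 Λ W ε₄ J 𝔄 + 𝔄)` under the scheme's and
  Sect. C's FLAT lists VERBATIM and the pinned binders: for `‖𝔄‖, ‖𝔄′‖ < a`,
  `‖π𝒴 Z(𝔄) − π𝒴 Z(𝔄′)‖ ≤ (1∕((1−s)(1−k)))·‖π𝒴 𝔄 − π𝒴 𝔄′‖` (file 1 §2 ∘ §3).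
* §2 THE CHART FORM = S70 (iv): `landauField_chart_zero` (`Z_V 0 = 0`) and **`norm_sub_landauField_chart_le`** — with
  `𝔄 = H₁ Φ z`, `Λ = 0`, `J = 0` EXACTLY as in `ShellMeasureLandauHolonomyPrint.slotAC_realized_su2_landauChart_print`,
  for every `z` in the chart ball `ball 0 r_Φ` (so at every complex ray point `w • cplx x`, `‖w‖ < r_Φ∕S`, `x ∈ cube`):
  `‖π𝒴 (Z_V z) − π𝒴 (Z_V 0)‖ ≤ z_pin` AND `‖π𝒴 (Z_V z)‖ ≤ z_pin`, **`z_pin := B₁ₚ·bₚ∕((1 − q_W)(1 − k))`**.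
WHERE IT SITS (journal l.16410, the S70 holder's SHAPE).  The holder's END `slotAC_realized_su2_landauChart_pinned`
INSTANTIATES the LD chain's `𝒴` with the pinned space itself (B11 Prop. 6's and Sect. C's schemes re-run THERE, so its
`z_pin` is the chain's own `z̄` and (P4)∕(44) are displayed in the pinned currency).  THIS file is the OTHER dictionary for
S70 (iii)∕(iv): the schemes stay in print's FLAT norm (115) — existence∕uniqueness by name — and only the VARIATION is
pinned, from pinned LIPSCHITZ binders (`hGWp` ⇐ `‖𝒢‖_{pin→pin}`·(the (P4) letter's pinned Lipschitz constant), `hCp` ⇐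
leaf-08's `ShellMeasureLandauDerivativeDecayPinned`); no pinned quadratic bound is asked.  Consumers: S71's displayed
`z_pin` binder (`ShellMeasureRayTermsPinned`, either supplier), and any END variant that keeps the schemes flat.
NOTHING in the countdown moves; NE7c NOT PROVED; spine PROVED 0∕9.  HONEST DEPENDENCY (cell): continuum YM on T⁴ ⇐
BetaPertH ∧ nine spine estimates (0/9 proved); BetaPertH ⇐ (D1) ∧ (D4) ∧ CAP+tail; G-an2-4 gates asym, D1 and NE2/3/4.
-/

noncomputable section

open Set Metric

namespace Summit.QuantumFields.BalabanUV.T4Continuum.ShellMeasureLandauPinnedField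

open Literature.MathematicalPhysics.QuantumFieldTheory.Balaban1983to89
open B11Prop6Scheme (mapT Prop4Hyp norm_arg_lt existsUnique_solution)
open ShellMeasureLandauHolonomy (solAt corrAt landauExp solAt_spec)
open ShellMeasureLandauPinnedFixedPoint (norm_sub_solAt_le norm_sub_corrAt_le solAt_zero_zero landauExp_zero)

variable {𝒴 𝒴' 𝒳 𝒵 ℬ : Type*} [NormedAddCommGroup 𝒴] [NormedSpace ℂ 𝒴] [NormedAddCommGroup 𝒴'] [NormedSpace ℂ 𝒴']
  [NormedAddCommGroup 𝒳] [NormedSpace ℂ 𝒳] [NormedAddCommGroup 𝒵] [NormedSpace ℂ 𝒵] [NormedAddCommGroup ℬ]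
  [NormedSpace ℂ ℬ]
variable {P𝒴 P𝒴' P𝒳 Pℬ : Type*} [NormedAddCommGroup P𝒴] [NormedSpace ℂ P𝒴] [NormedAddCommGroup P𝒴']
  [NormedSpace ℂ P𝒴'] [NormedAddCommGroup P𝒳] [NormedSpace ℂ P𝒳] [NormedAddCommGroup Pℬ] [NormedSpace ℂ Pℬ]

/-! ## §1 The exponent field as a function of the datum `𝔄` -/

section Field

variable (π𝒴 : 𝒴 →L[ℂ] P𝒴) (π𝒴' : 𝒴' →L[ℂ] P𝒴') (π𝒳 : 𝒳 →L[ℂ] P𝒳)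
  {𝒢 : 𝒵 →L[ℂ] 𝒴} {Λ : 𝒴 →L[ℂ] 𝒴} {W : 𝒴 → 𝒵} {J : 𝒵} {B₀ θ C₄ a₃ j ε₄ a θp qW : ℝ}
  {C : 𝒴' → 𝒳} {ι : 𝒴 →L[ℂ] 𝒴'} {H : 𝒳 →L[ℂ] 𝒴} {C₂ R LC cι BH : ℝ}

/-- **THE EXPONENT FIELD READ IN A SECOND NORM, AS A FUNCTION OF THE DATUM.**
`Z(𝔄) := landauExp C ι H (4C₂(ε₄+a)²) (solAt 𝒢 Λ W ε₄ J 𝔄 + 𝔄)`.  FLAT binders: the scheme's list ((P2) `h𝒢`∕`hΛ`,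
(P4) `hW`, (118)∕(121), `‖J‖ ≤ j`) and Sect. C's list at `ε := ε₄ + a` ((44) `hCq`∕`hCd`, `hι`, (46) `hH`,
`9C₂B₀(ε₄+a) < 1`, `3(ε₄+a) ≤ R`).  PINNED binders: `hΛp`, `hGWp` (`s = θₚ + q_W < 1`), `hCp`, `hιp`, `hHp`
(`k = L_C c_ι B_H < 1`).  CONCLUSION: for `‖𝔄‖, ‖𝔄′‖ < a`,
`‖π𝒴 Z(𝔄) − π𝒴 Z(𝔄′)‖ ≤ (1∕((1−s)(1−k)))·‖π𝒴 𝔄 − π𝒴 𝔄′‖`. [folklore] -/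
theorem norm_sub_landauField_le [CompleteSpace 𝒴] [CompleteSpace 𝒳]
    (h𝒢 : ∀ f, ‖𝒢 f‖ ≤ B₀ * ‖f‖) (hΛ : ∀ Y, ‖Λ Y‖ ≤ θ * ‖Y‖) (hW : Prop4Hyp W C₄ a₃) (hB₀ : 0 ≤ B₀)
    (hC₄ : 0 ≤ C₄) (hθ : 0 ≤ θ) (hε₄ : 0 ≤ ε₄) (hdom : 2 * (ε₄ + a) ≤ a₃)
    (hself : B₀ * j + θ * (ε₄ + a) + B₀ * C₄ * (ε₄ + a) ^ 2 ≤ ε₄) (hcontr : θ + 4 * B₀ * C₄ * (ε₄ + a) < 1)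
    (hJ : ‖J‖ ≤ j)
    (hC₂ : 0 ≤ C₂) (hCq : ∀ Z : 𝒴', ‖Z‖ < R → ‖C Z‖ ≤ C₂ * ‖Z‖ ^ 2) (hCd : DifferentiableOn ℂ C (ball 0 R))
    (hι : ∀ Y, ‖ι Y‖ ≤ ‖Y‖) (hH : ∀ X, ‖H X‖ ≤ B₀ * ‖X‖) (hq : 9 * C₂ * B₀ * (ε₄ + a) < 1)
    (hRC : 3 * (ε₄ + a) ≤ R)
    (hΛp : ∀ Y, ‖π𝒴 (Λ Y)‖ ≤ θp * ‖π𝒴 Y‖)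
    (hGWp : ∀ Y Y', ‖Y‖ < ε₄ + a → ‖Y'‖ < ε₄ + a →
      ‖π𝒴 (𝒢 (W Y)) - π𝒴 (𝒢 (W Y'))‖ ≤ qW * ‖π𝒴 Y - π𝒴 Y'‖)
    (hs : θp + qW < 1)
    (hCp : ∀ A A' : 𝒴', ‖A‖ < R → ‖A'‖ < R → ‖π𝒳 (C A) - π𝒳 (C A')‖ ≤ LC * ‖π𝒴' A - π𝒴' A'‖)
    (hιp : ∀ Y, ‖π𝒴' (ι Y)‖ ≤ cι * ‖π𝒴 Y‖) (hHp : ∀ X, ‖π𝒴 (H X)‖ ≤ BH * ‖π𝒳 X‖)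
    (hLC : 0 ≤ LC) (hcι : 0 ≤ cι) (hBH : 0 ≤ BH) (hk : LC * cι * BH < 1)
    {𝔄 𝔄' : 𝒴} (h𝔄 : ‖𝔄‖ < a) (h𝔄' : ‖𝔄'‖ < a) :
    ‖π𝒴 (landauExp C ι H (4 * C₂ * (ε₄ + a) ^ 2) (solAt 𝒢 Λ W ε₄ J 𝔄 + 𝔄)) -
        π𝒴 (landauExp C ι H (4 * C₂ * (ε₄ + a) ^ 2) (solAt 𝒢 Λ W ε₄ J 𝔄' + 𝔄'))‖ ≤
      1 / ((1 - (θp + qW)) * (1 - LC * cι * BH)) * ‖π𝒴 𝔄 - π𝒴 𝔄'‖ := by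
  have hsol : ∀ {𝔄₀ : 𝒴}, ‖𝔄₀‖ < a → ‖solAt 𝒢 Λ W ε₄ J 𝔄₀‖ ≤ ε₄ := fun h𝔄₀ =>
    (solAt_spec (existsUnique_solution h𝒢 hΛ hW.quadAnalytic hB₀ hC₄ hθ hJ h𝔄₀ hε₄ hdom hself hcontr).exists).1
  have hY : ‖solAt 𝒢 Λ W ε₄ J 𝔄 + 𝔄‖ < ε₄ + a := norm_arg_lt h𝔄 (hsol h𝔄)
  have hY' : ‖solAt 𝒢 Λ W ε₄ J 𝔄' + 𝔄'‖ < ε₄ + a := norm_arg_lt h𝔄' (hsol h𝔄')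
  have h1 := (norm_sub_corrAt_le π𝒴 π𝒴' π𝒳 hC₂ hCq hCd hι hB₀ hH hq hRC hCp hιp hHp hLC hcι hBH hk hY hY').2
  have h2 := (norm_sub_solAt_le π𝒴 h𝒢 hΛ hW hB₀ hC₄ hθ hε₄ hdom hself hcontr hJ hΛp hGWp hs h𝔄 h𝔄').2
  have hk1 : 0 < 1 - LC * cι * BH := by linarith
  have hs1 : 0 < 1 - (θp + qW) := by linarith
  calc _ ≤ 1 / (1 - LC * cι * BH) *
        ‖π𝒴 (solAt 𝒢 Λ W ε₄ J 𝔄 + 𝔄) - π𝒴 (solAt 𝒢 Λ W ε₄ J 𝔄' + 𝔄')‖ := h1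
    _ ≤ 1 / (1 - LC * cι * BH) * (1 / (1 - (θp + qW)) * ‖π𝒴 𝔄 - π𝒴 𝔄'‖) :=
        mul_le_mul_of_nonneg_left h2 (div_nonneg zero_le_one hk1.le)
    _ = 1 / ((1 - (θp + qW)) * (1 - LC * cι * BH)) * ‖π𝒴 𝔄 - π𝒴 𝔄'‖ := by
        rw [← mul_assoc, one_div_mul_one_div, mul_comm (1 - LC * cι * BH)]

end Field

/-! ## §2 The chart form — S70 (iv): `‖Z_V(z) − Z_V(0)‖_pin ≤ z_pin` on the chart ball -/

section Chart

variable (π𝒴 : 𝒴 →L[ℂ] P𝒴) (π𝒴' : 𝒴' →L[ℂ] P𝒴') (π𝒳 : 𝒳 →L[ℂ] P𝒳) (πℬ : ℬ →L[ℂ] Pℬ)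
  {m₀ : ℕ} {𝒢 : 𝒵 →L[ℂ] 𝒴} {W : 𝒴 → 𝒵} {B₀ C₄ a₃ ε₄ b qW : ℝ}
  {C : 𝒴' → 𝒳} {ι : 𝒴 →L[ℂ] 𝒴'} {H : 𝒳 →L[ℂ] 𝒴} {C₂ R LC cι BH : ℝ}
  {H₁ : ℬ →L[ℂ] 𝒴} {Φ : (Fin m₀ → ℂ) → ℬ} {rΦ B₁p bp : ℝ}

/-- **THE EXPONENT FIELD VANISHES AT THE CHART CENTRE**: with `Φ 0 = 0`, `0 < b`, the scheme's flat list at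
`a = B₀b` (`Λ = 0`, `J = 0`) and Sect. C's flat list at `ε = ε₄ + B₀b`:
`landauExp C ι H (4C₂(ε₄+B₀b)²) (solAt 𝒢 0 W ε₄ 0 (H₁ (Φ 0)) + H₁ (Φ 0)) = 0`. [folklore] -/
theorem landauField_chart_zero [CompleteSpace 𝒴] [CompleteSpace 𝒳]
    (h𝒢 : ∀ f, ‖𝒢 f‖ ≤ B₀ * ‖f‖) (hW : Prop4Hyp W C₄ a₃) (hB₀ : 0 < B₀) (hC₄ : 0 ≤ C₄) (hε₄ : 0 ≤ ε₄)
    (hb : 0 < b) (hdom : 2 * (ε₄ + B₀ * b) ≤ a₃) (hself : B₀ * C₄ * (ε₄ + B₀ * b) ^ 2 ≤ ε₄)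
    (hcontr : 4 * B₀ * C₄ * (ε₄ + B₀ * b) < 1) (hΦ0 : Φ 0 = 0)
    (hC₂ : 0 ≤ C₂) (hCq : ∀ Z : 𝒴', ‖Z‖ < R → ‖C Z‖ ≤ C₂ * ‖Z‖ ^ 2) (hCd : DifferentiableOn ℂ C (ball 0 R))
    (hι : ∀ Y, ‖ι Y‖ ≤ ‖Y‖) (hH : ∀ X, ‖H X‖ ≤ B₀ * ‖X‖) (hq : 9 * C₂ * B₀ * (ε₄ + B₀ * b) < 1)
    (hRC : 3 * (ε₄ + B₀ * b) ≤ R) :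
    landauExp C ι H (4 * C₂ * (ε₄ + B₀ * b) ^ 2) (solAt 𝒢 0 W ε₄ (0 : 𝒵) (H₁ (Φ 0)) + H₁ (Φ 0)) = 0 := by
  have hΛ : ∀ Y : 𝒴, ‖(0 : 𝒴 →L[ℂ] 𝒴) Y‖ ≤ 0 * ‖Y‖ := fun Y => by simp
  have hself' : B₀ * 0 + 0 * (ε₄ + B₀ * b) + B₀ * C₄ * (ε₄ + B₀ * b) ^ 2 ≤ ε₄ := by simpa using hself
  have hcontr' : 0 + 4 * B₀ * C₄ * (ε₄ + B₀ * b) < 1 := by simpa using hcontr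
  have ha : 0 < B₀ * b := mul_pos hB₀ hb
  rw [hΦ0, map_zero, add_zero, solAt_zero_zero h𝒢 hΛ hW hB₀.le hC₄ le_rfl hε₄ ha hdom hself' hcontr']
  exact landauExp_zero hC₂ hCq hCd hι hB₀.le hH hq hRC (add_pos_of_nonneg_of_pos hε₄ ha)

/-- **S70 (iv) — THE PINNED VARIATION OF THE EXPONENT FIELD ON THE CHART BALL.**  FLAT binders VERBATIM from the LD END
(`ShellMeasureLandauHolonomyPrint.landauField_mem_ball`'s list: (P2) `h𝒢`, (P4) `hW`, (118)∕(121) at `a = B₀b`, (103)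
`hH₁`, (75)-TYPE `hΦ` with `Φ 0 = 0`, (44) `hCq`∕`hCd`, scaling `hι`, (46) `hH`, (54) `hq`, `hRC`).  PINNED binders
(DISPLAYED, to be inhabited by S70 f1 ∕ leaf-08's `DCf` file in S69's currency): `hGWp` (`q_W < 1`), `hCp`, `hιp`, `hHp`
(`k = L_C c_ι B_H < 1`), `hH₁p : ‖π𝒴(H₁ B)‖ ≤ B₁ₚ‖πℬ B‖`, `hΦp : ‖πℬ(Φ z)‖ ≤ bₚ` on `ball 0 r_Φ`.  CONCLUSION, for the
exponent field `Z_V z = landauExp C ι H (4C₂(ε₄+B₀b)²) (solAt 𝒢 0 W ε₄ 0 (H₁ (Φ z)) + H₁ (Φ z))` and every `z` in the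
chart ball: `‖π𝒴 (Z_V z) − π𝒴 (Z_V 0)‖ ≤ z_pin` and `‖π𝒴 (Z_V z)‖ ≤ z_pin`, **`z_pin = B₁ₚ·bₚ∕((1 − q_W)(1 − k))`**.
Nothing printed is asserted; no estimate of Bałaban's discharged; NE7c NOT PROVED. [folklore] -/
theorem norm_sub_landauField_chart_le [CompleteSpace 𝒴] [CompleteSpace 𝒳]
    (h𝒢 : ∀ f, ‖𝒢 f‖ ≤ B₀ * ‖f‖) (hW : Prop4Hyp W C₄ a₃) (hB₀ : 0 < B₀) (hC₄ : 0 ≤ C₄) (hε₄ : 0 ≤ ε₄)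
    (hdom : 2 * (ε₄ + B₀ * b) ≤ a₃) (hself : B₀ * C₄ * (ε₄ + B₀ * b) ^ 2 ≤ ε₄)
    (hcontr : 4 * B₀ * C₄ * (ε₄ + B₀ * b) < 1)
    (hH₁ : ∀ B, ‖H₁ B‖ ≤ B₀ * ‖B‖) (hΦ0 : Φ 0 = 0) (hΦ : ∀ z ∈ ball (0 : Fin m₀ → ℂ) rΦ, ‖Φ z‖ < b)
    (hC₂ : 0 ≤ C₂) (hCq : ∀ Z : 𝒴', ‖Z‖ < R → ‖C Z‖ ≤ C₂ * ‖Z‖ ^ 2) (hCd : DifferentiableOn ℂ C (ball 0 R))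
    (hι : ∀ Y, ‖ι Y‖ ≤ ‖Y‖) (hH : ∀ X, ‖H X‖ ≤ B₀ * ‖X‖) (hq : 9 * C₂ * B₀ * (ε₄ + B₀ * b) < 1)
    (hRC : 3 * (ε₄ + B₀ * b) ≤ R)
    -- the pinned binders
    (hGWp : ∀ Y Y', ‖Y‖ < ε₄ + B₀ * b → ‖Y'‖ < ε₄ + B₀ * b →
      ‖π𝒴 (𝒢 (W Y)) - π𝒴 (𝒢 (W Y'))‖ ≤ qW * ‖π𝒴 Y - π𝒴 Y'‖) (hqW : qW < 1)
    (hCp : ∀ A A' : 𝒴', ‖A‖ < R → ‖A'‖ < R → ‖π𝒳 (C A) - π𝒳 (C A')‖ ≤ LC * ‖π𝒴' A - π𝒴' A'‖)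
    (hιp : ∀ Y, ‖π𝒴' (ι Y)‖ ≤ cι * ‖π𝒴 Y‖) (hHp : ∀ X, ‖π𝒴 (H X)‖ ≤ BH * ‖π𝒳 X‖)
    (hLC : 0 ≤ LC) (hcι : 0 ≤ cι) (hBH : 0 ≤ BH) (hk : LC * cι * BH < 1)
    (hB₁p : 0 ≤ B₁p) (hH₁p : ∀ B, ‖π𝒴 (H₁ B)‖ ≤ B₁p * ‖πℬ B‖)
    (hΦp : ∀ z ∈ ball (0 : Fin m₀ → ℂ) rΦ, ‖πℬ (Φ z)‖ ≤ bp) {z : Fin m₀ → ℂ} (hz : z ∈ ball (0 : Fin m₀ → ℂ) rΦ) :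
    ‖π𝒴 (landauExp C ι H (4 * C₂ * (ε₄ + B₀ * b) ^ 2) (solAt 𝒢 0 W ε₄ (0 : 𝒵) (H₁ (Φ z)) + H₁ (Φ z))) -
        π𝒴 (landauExp C ι H (4 * C₂ * (ε₄ + B₀ * b) ^ 2) (solAt 𝒢 0 W ε₄ (0 : 𝒵) (H₁ (Φ 0)) + H₁ (Φ 0)))‖ ≤
      B₁p * bp / ((1 - qW) * (1 - LC * cι * BH)) ∧
    ‖π𝒴 (landauExp C ι H (4 * C₂ * (ε₄ + B₀ * b) ^ 2) (solAt 𝒢 0 W ε₄ (0 : 𝒵) (H₁ (Φ z)) + H₁ (Φ z)))‖ ≤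
      B₁p * bp / ((1 - qW) * (1 - LC * cι * BH)) := by
  have hrΦ : 0 < rΦ := by
    have h := mem_ball_zero_iff.1 hz
    exact (norm_nonneg _).trans_lt h
  have h0 : (0 : Fin m₀ → ℂ) ∈ ball (0 : Fin m₀ → ℂ) rΦ := mem_ball_self hrΦ
  have hb : 0 < b := by have h := hΦ 0 h0; rwa [hΦ0, norm_zero] at h
  have hΛ : ∀ Y : 𝒴, ‖(0 : 𝒴 →L[ℂ] 𝒴) Y‖ ≤ 0 * ‖Y‖ := fun Y => by simp
  have hΛp : ∀ Y : 𝒴, ‖π𝒴 ((0 : 𝒴 →L[ℂ] 𝒴) Y)‖ ≤ 0 * ‖π𝒴 Y‖ := fun Y => by simp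
  have hself' : B₀ * 0 + 0 * (ε₄ + B₀ * b) + B₀ * C₄ * (ε₄ + B₀ * b) ^ 2 ≤ ε₄ := by simpa using hself
  have hcontr' : 0 + 4 * B₀ * C₄ * (ε₄ + B₀ * b) < 1 := by simpa using hcontr
  have hJ : ‖(0 : 𝒵)‖ ≤ 0 := by rw [norm_zero]
  have hs : 0 + qW < 1 := by simpa using hqW
  have h𝔄 : ∀ {z₀}, z₀ ∈ ball (0 : Fin m₀ → ℂ) rΦ → ‖H₁ (Φ z₀)‖ < B₀ * b := fun hz₀ =>
    (hH₁ _).trans_lt (mul_lt_mul_of_pos_left (hΦ _ hz₀) hB₀)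
  have hvar := norm_sub_landauField_le π𝒴 π𝒴' π𝒳 h𝒢 hΛ hW hB₀.le hC₄ le_rfl hε₄ hdom hself' hcontr' hJ hC₂ hCq
    hCd hι hH hq hRC hΛp hGWp hs hCp hιp hHp hLC hcι hBH hk (h𝔄 hz) (h𝔄 h0)
  have hzero := landauField_chart_zero (H₁ := H₁) h𝒢 hW hB₀ hC₄ hε₄ hb hdom hself hcontr hΦ0 hC₂ hCq hCd
    hι hH hq hRC
  have hk1 : 0 < 1 - LC * cι * BH := by linarith
  have hs1 : 0 < 1 - qW := by linarith
  -- the datum's pinned size: `‖π𝒴(H₁ Φ z) − π𝒴(H₁ Φ 0)‖ ≤ B₁ₚ bₚ`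
  have hdat : ‖π𝒴 (H₁ (Φ z)) - π𝒴 (H₁ (Φ 0))‖ ≤ B₁p * bp := by
    simp only [hΦ0, map_zero, sub_zero]
    exact (hH₁p _).trans (mul_le_mul_of_nonneg_left (hΦp z hz) hB₁p)
  have hmain : ‖π𝒴 (landauExp C ι H (4 * C₂ * (ε₄ + B₀ * b) ^ 2)
        (solAt 𝒢 0 W ε₄ (0 : 𝒵) (H₁ (Φ z)) + H₁ (Φ z))) -
      π𝒴 (landauExp C ι H (4 * C₂ * (ε₄ + B₀ * b) ^ 2)
        (solAt 𝒢 0 W ε₄ (0 : 𝒵) (H₁ (Φ 0)) + H₁ (Φ 0)))‖ ≤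
      B₁p * bp / ((1 - qW) * (1 - LC * cι * BH)) :=
    calc _ ≤ 1 / ((1 - (0 + qW)) * (1 - LC * cι * BH)) * ‖π𝒴 (H₁ (Φ z)) - π𝒴 (H₁ (Φ 0))‖ := hvar
      _ ≤ 1 / ((1 - (0 + qW)) * (1 - LC * cι * BH)) * (B₁p * bp) :=
          mul_le_mul_of_nonneg_left hdat (by rw [zero_add]; exact div_nonneg zero_le_one (mul_pos hs1 hk1).le)
      _ = B₁p * bp / ((1 - qW) * (1 - LC * cι * BH)) := by rw [zero_add, one_div_mul_eq_div]
  refine ⟨hmain, ?_⟩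
  rwa [hzero, map_zero, sub_zero] at hmain

end Chart

end Summit.QuantumFields.BalabanUV.T4Continuum.ShellMeasureLandauPinnedField

end
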